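import Mathlib

/-!
# The difference Ahlswede–Daykin theorem (DAD) and the fibre four-functions theorem (blind cell
PercRepro2, typer-1; lead g10 `LEAD-PROOFSHAPES.md` ADDENDUM 23 (1)–(3), ask 2026-08-23T06:21:47Z)

For a finite ground set `A` and `x, x′, z, z′ : Finset α → R` nonnegative with
`x(S) x′(T) ≤ z(S ∖ T) z′(T ∖ S)` for all `S, T ⊆ A`:

* **`dad_full`**: `(Σ_{S ⊆ A} x S) (Σ_{T ⊆ A} x′ T) ≤ (Σ_{U ⊆ A} z U) (Σ_{V ⊆ A} z′ V)` — induction on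
  the ground set; the one-element lemma `one_elem` `(x₀ + x₁)(x′₀ + x′₁) ≤ (z₀ + z₁)(z′₀ + z′₁)` from
  the four single hypotheses uses the product identities `pq = rs`, `βγ = αδ` (ADDENDUM 23 (1));
* **`dad`**: the family form `x(𝒳) x′(𝒴) ≤ z(𝒳 ⊖ 𝒴) z′(𝒴 ⊖ 𝒳)` with `𝒳 ⊖ 𝒴 = {S ∖ T}` as a set
  (`sdiffFam`), by applying `dad_full` to the functions restricted to the families;
* **`lemma_L`** (the diagonal): `x(S) x(T) ≤ z(S ∖ T) z(T ∖ S)` for all `S, T ⊆ A` gives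
  `Σ_{S ⊆ A} x S ≤ Σ_{W ⊆ A} z W`;
* **`fibreFFT`** (the fibre four-functions theorem, two-pinning form): under the Ahlswede–Daykin
  hypothesis `α(S) β(T) ≤ γ(S ∪ T) δ(S ∩ T)`, for every free set `E′` and pinnings `z₁, z₂` disjoint
  from `E′`, `Σ_{r ⊆ E′} α(z₁ ∪ r) β(z₂ ∪ (E′ ∖ r)) ≤ Σ_{r ⊆ E′} γ(z₁ ∪ z₂ ∪ r) δ((z₁ ∩ z₂) ∪ (E′ ∖ r))` —
  every typed two-copy base of an AD-instance inequality has the right sign;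
* **`fibreHarris`**: for up-sets `𝒰, 𝒱` of subsets, every fibre count
  `#{r ⊆ E′ : z₁ ∪ r ∈ 𝒰, z₂ ∪ (E′ ∖ r) ∈ 𝒱} ≤ #{r ⊆ E′ : z₁ ∪ z₂ ∪ r ∈ 𝒰 ∩ 𝒱}` (Kleitman's
  inequality fibre by fibre).
Self-contained (Mathlib only).
-/

namespace Summit.Ventures.PercRepro2

namespace DAD

section OneElem

variable {R : Type*} [Field R] [LinearOrder R] [IsStrictOrderedRing R]

/-- **The one-element lemma**: from `x₀ y₀ ≤ z₀ w₀`, `x₁ y₁ ≤ z₀ w₀`, `x₀ y₁ ≤ z₀ w₁`, `x₁ y₀ ≤ z₁ w₀`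
(all nonnegative), `(x₀ + x₁)(y₀ + y₁) ≤ (z₀ + z₁)(w₀ + w₁)`. -/
lemma one_elem {x₀ x₁ y₀ y₁ z₀ z₁ w₀ w₁ : R} (_hx₀ : 0 ≤ x₀) (hx₁ : 0 ≤ x₁) (hy₀ : 0 ≤ y₀)
    (_hy₁ : 0 ≤ y₁) (hz₀ : 0 ≤ z₀) (hz₁ : 0 ≤ z₁) (hw₀ : 0 ≤ w₀) (hw₁ : 0 ≤ w₁)
    (h₀₀ : x₀ * y₀ ≤ z₀ * w₀) (h₁₁ : x₁ * y₁ ≤ z₀ * w₀) (h₀₁ : x₀ * y₁ ≤ z₀ * w₁)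
    (h₁₀ : x₁ * y₀ ≤ z₁ * w₀) :
    (x₀ + x₁) * (y₀ + y₁) ≤ (z₀ + z₁) * (w₀ + w₁) := by
  have key : x₀ * y₀ + x₁ * y₁ ≤ z₀ * w₀ + z₁ * w₁ := by
    rcases eq_or_lt_of_le (mul_nonneg hz₀ hw₀) with hα | hα
    · nlinarith [mul_nonneg hz₁ hw₁]
    · have h1 : (z₀ * w₀) * (x₀ * y₀ + x₁ * y₁) ≤ (z₀ * w₀) * (z₀ * w₀ + z₁ * w₁) := by
        nlinarith [mul_nonneg (sub_nonneg.2 h₀₀) (sub_nonneg.2 h₁₁),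
          mul_le_mul h₀₁ h₁₀ (mul_nonneg hx₁ hy₀) (mul_nonneg hz₀ hw₁)]
      exact le_of_mul_le_mul_left h1 hα
  nlinarith [key, h₀₁, h₁₀]

end OneElem

section Sets

variable {α : Type*} [DecidableEq α]

/-- `(insert n S) ∖ (insert n T) = S ∖ T` when `n ∉ S`. -/
lemma insert_sdiff_insert_of_notMem {S T : Finset α} {n : α} (hn : n ∉ S) :
    insert n S \ insert n T = S \ T := by
  ext a
  simp only [Finset.mem_sdiff, Finset.mem_insert, not_or]
  constructor
  · rintro ⟨ha, hn', hT⟩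
    rcases ha with rfl | ha
    · exact absurd rfl hn'
    · exact ⟨ha, hT⟩
  · rintro ⟨ha, hT⟩
    exact ⟨Or.inr ha, fun h => hn (h ▸ ha), hT⟩

/-- `S ∖ (insert n T) = S ∖ T` when `n ∉ S`. -/
lemma sdiff_insert_of_notMem {S T : Finset α} {n : α} (hn : n ∉ S) :
    S \ insert n T = S \ T := by
  ext a
  simp only [Finset.mem_sdiff, Finset.mem_insert, not_or]
  constructor
  · rintro ⟨ha, _, hT⟩
    exact ⟨ha, hT⟩
  · rintro ⟨ha, hT⟩
    exact ⟨ha, fun h => hn (h ▸ ha), hT⟩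

/-- `(insert n S) ∖ T = insert n (S ∖ T)` when `n ∉ T`. -/
lemma insert_sdiff_of_notMem {S T : Finset α} {n : α} (hn : n ∉ T) :
    insert n S \ T = insert n (S \ T) := by
  ext a
  simp only [Finset.mem_sdiff, Finset.mem_insert]
  constructor
  · rintro ⟨ha, hT⟩
    rcases ha with rfl | ha
    · exact Or.inl rfl
    · exact Or.inr ⟨ha, hT⟩
  · rintro (rfl | ⟨ha, hT⟩)
    · exact ⟨Or.inl rfl, hn⟩
    · exact ⟨Or.inr ha, hT⟩

end Sets

section Full

variable {α : Type*} [DecidableEq α] {R : Type*} [Field R] [LinearOrder R] [IsStrictOrderedRing R]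

/-- **DAD, full form**: under `x(S) x′(T) ≤ z(S ∖ T) z′(T ∖ S)` for all `S, T ⊆ A` (nonnegative
functions), `(Σ_{S ⊆ A} x S)(Σ_{T ⊆ A} x′ T) ≤ (Σ_{U ⊆ A} z U)(Σ_{V ⊆ A} z′ V)`. -/
theorem dad_full (A : Finset α) :
    ∀ (x x' z z' : Finset α → R), (∀ S, 0 ≤ x S) → (∀ S, 0 ≤ x' S) → (∀ S, 0 ≤ z S) →
      (∀ S, 0 ≤ z' S) →
      (∀ S ⊆ A, ∀ T ⊆ A, x S * x' T ≤ z (S \ T) * z' (T \ S)) →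
      (∑ S ∈ A.powerset, x S) * (∑ T ∈ A.powerset, x' T) ≤
        (∑ U ∈ A.powerset, z U) * (∑ V ∈ A.powerset, z' V) := by
  induction A using Finset.induction_on with
  | empty =>
    intro x x' z z' _ _ _ _ H
    simp only [Finset.powerset_empty, Finset.sum_singleton]
    simpa using H ∅ (Finset.Subset.refl _) ∅ (Finset.Subset.refl _)
  | @insert n A' hn ih =>
    intro x x' z z' hx hx' hz hz' H
    rw [Finset.sum_powerset_insert hn, Finset.sum_powerset_insert hn, Finset.sum_powerset_insert hn,
      Finset.sum_powerset_insert hn, ← Finset.sum_add_distrib, ← Finset.sum_add_distrib,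
      ← Finset.sum_add_distrib, ← Finset.sum_add_distrib]
    -- the induction hypothesis for the "bar" functions on `A'`
    refine ih (fun S => x S + x (insert n S)) (fun T => x' T + x' (insert n T))
      (fun U => z U + z (insert n U)) (fun V => z' V + z' (insert n V))
      (fun S => add_nonneg (hx S) (hx _)) (fun S => add_nonneg (hx' S) (hx' _))
      (fun S => add_nonneg (hz S) (hz _)) (fun S => add_nonneg (hz' S) (hz' _)) ?_
    intro S hS T hT
    have hnS : n ∉ S := fun h => hn (hS h)
    have hnT : n ∉ T := fun h => hn (hT h)
    have hS' : S ⊆ insert n A' := hS.trans (Finset.subset_insert n A')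
    have hT' : T ⊆ insert n A' := hT.trans (Finset.subset_insert n A')
    have hS'' : insert n S ⊆ insert n A' := Finset.insert_subset_insert n hS
    have hT'' : insert n T ⊆ insert n A' := Finset.insert_subset_insert n hT
    have h₀₀ := H S hS' T hT'
    have h₁₁ := H (insert n S) hS'' (insert n T) hT''
    have h₀₁ := H S hS' (insert n T) hT''
    have h₁₀ := H (insert n S) hS'' T hT'
    rw [insert_sdiff_insert_of_notMem hnS, insert_sdiff_insert_of_notMem hnT] at h₁₁
    rw [sdiff_insert_of_notMem hnS, insert_sdiff_of_notMem hnS] at h₀₁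
    rw [insert_sdiff_of_notMem hnT, sdiff_insert_of_notMem hnT] at h₁₀
    exact one_elem (hx S) (hx _) (hx' T) (hx' _) (hz _) (hz _) (hz' _) (hz' _) h₀₀ h₁₁ h₀₁ h₁₀

end Full

section Families

variable {α : Type*} [DecidableEq α] {R : Type*} [Field R] [LinearOrder R] [IsStrictOrderedRing R]

/-- `𝒳 ⊖ 𝒴 = {S ∖ T : S ∈ 𝒳, T ∈ 𝒴}` (a set, no multiplicity). -/
def sdiffFam (𝒳 𝒴 : Finset (Finset α)) : Finset (Finset α) :=
  Finset.image₂ (fun S T => S \ T) 𝒳 𝒴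

/-- Membership in `𝒳 ⊖ 𝒴`. -/
lemma mem_sdiffFam {𝒳 𝒴 : Finset (Finset α)} {U : Finset α} :
    U ∈ sdiffFam 𝒳 𝒴 ↔ ∃ S ∈ 𝒳, ∃ T ∈ 𝒴, S \ T = U := by
  simp [sdiffFam, Finset.mem_image₂]

/-- `𝒳 ⊖ 𝒴 ⊆ 2^A` when `𝒳 ⊆ 2^A`. -/
lemma sdiffFam_subset_powerset {A : Finset α} {𝒳 𝒴 : Finset (Finset α)}
    (h𝒳 : 𝒳 ⊆ A.powerset) : sdiffFam 𝒳 𝒴 ⊆ A.powerset := by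
  intro U hU
  obtain ⟨S, hS, T, _, rfl⟩ := mem_sdiffFam.1 hU
  exact Finset.mem_powerset.2 (Finset.sdiff_subset.trans (Finset.mem_powerset.1 (h𝒳 hS)))

/-- **DAD, family form** (ADDENDUM 23 (1)): `x(𝒳) x′(𝒴) ≤ z(𝒳 ⊖ 𝒴) z′(𝒴 ⊖ 𝒳)`. -/
theorem dad (A : Finset α) (x x' z z' : Finset α → R) (hx : ∀ S, 0 ≤ x S) (hx' : ∀ S, 0 ≤ x' S)
    (hz : ∀ S, 0 ≤ z S) (hz' : ∀ S, 0 ≤ z' S)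
    (H : ∀ S ⊆ A, ∀ T ⊆ A, x S * x' T ≤ z (S \ T) * z' (T \ S))
    (𝒳 𝒴 : Finset (Finset α)) (h𝒳 : 𝒳 ⊆ A.powerset) (h𝒴 : 𝒴 ⊆ A.powerset) :
    (∑ S ∈ 𝒳, x S) * (∑ T ∈ 𝒴, x' T) ≤
      (∑ U ∈ sdiffFam 𝒳 𝒴, z U) * (∑ V ∈ sdiffFam 𝒴 𝒳, z' V) := by
  have key := dad_full A (fun S => if S ∈ 𝒳 then x S else 0) (fun T => if T ∈ 𝒴 then x' T else 0)
    (fun U => if U ∈ sdiffFam 𝒳 𝒴 then z U else 0) (fun V => if V ∈ sdiffFam 𝒴 𝒳 then z' V else 0)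
    (fun S => by split_ifs <;> simp [hx]) (fun S => by split_ifs <;> simp [hx'])
    (fun S => by split_ifs <;> simp [hz]) (fun S => by split_ifs <;> simp [hz'])
    (by
      intro S _ T _
      by_cases hS : S ∈ 𝒳
      · by_cases hT : T ∈ 𝒴
        · have hU : S \ T ∈ sdiffFam 𝒳 𝒴 := mem_sdiffFam.2 ⟨S, hS, T, hT, rfl⟩
          have hV : T \ S ∈ sdiffFam 𝒴 𝒳 := mem_sdiffFam.2 ⟨T, hT, S, hS, rfl⟩
          simp only [if_pos hS, if_pos hT, if_pos hU, if_pos hV]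
          exact H S ‹_› T ‹_›
        · simp only [if_pos hS, if_neg hT, mul_zero]
          split_ifs <;> simp [mul_nonneg, hz, hz']
      · simp only [if_neg hS, zero_mul]
        split_ifs <;> simp [mul_nonneg, hz, hz'])
  simp only [Finset.sum_ite_mem, Finset.inter_eq_right.2 h𝒳, Finset.inter_eq_right.2 h𝒴,
    Finset.inter_eq_right.2 (sdiffFam_subset_powerset h𝒳),
    Finset.inter_eq_right.2 (sdiffFam_subset_powerset h𝒴)] at key
  exact key

/-- **Lemma L (the diagonal)**: `x(S) x(T) ≤ z(S ∖ T) z(T ∖ S)` for all `S, T ⊆ A` gives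
`Σ_{S ⊆ A} x S ≤ Σ_{W ⊆ A} z W`. -/
theorem lemma_L (A : Finset α) (x z : Finset α → R) (hx : ∀ S, 0 ≤ x S) (hz : ∀ S, 0 ≤ z S)
    (H : ∀ S ⊆ A, ∀ T ⊆ A, x S * x T ≤ z (S \ T) * z (T \ S)) :
    ∑ S ∈ A.powerset, x S ≤ ∑ W ∈ A.powerset, z W := by
  have h := dad_full A x x z z hx hx hz hz H
  have hxs : 0 ≤ ∑ S ∈ A.powerset, x S := Finset.sum_nonneg fun S _ => hx S
  have hzs : 0 ≤ ∑ W ∈ A.powerset, z W := Finset.sum_nonneg fun S _ => hz S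
  nlinarith [h, hxs, hzs]

end Families

section Fibre

variable {α : Type*} [DecidableEq α] {R : Type*} [Field R] [LinearOrder R] [IsStrictOrderedRing R]

/-- `(z₁ ∪ S) ∪ (z₂ ∪ (E ∖ T)) = z₁ ∪ z₂ ∪ (E ∖ (T ∖ S))` for `S ⊆ E`. -/
lemma union_pin_eq {E z₁ z₂ S T : Finset α} (hS : S ⊆ E) :
    (z₁ ∪ S) ∪ (z₂ ∪ (E \ T)) = z₁ ∪ z₂ ∪ (E \ (T \ S)) := by
  ext a
  simp only [Finset.mem_union, Finset.mem_sdiff, not_and, not_not]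
  constructor
  · rintro ((h | h) | (h | ⟨hE, hT⟩))
    · exact Or.inl (Or.inl h)
    · exact Or.inr ⟨hS h, fun _ => h⟩
    · exact Or.inl (Or.inr h)
    · exact Or.inr ⟨hE, fun h' => absurd h' hT⟩
  · rintro ((h | h) | ⟨hE, hTS⟩)
    · exact Or.inl (Or.inl h)
    · exact Or.inr (Or.inl h)
    · by_cases hT : a ∈ T
      · exact Or.inl (Or.inr (hTS hT))
      · exact Or.inr (Or.inr ⟨hE, hT⟩)

/-- `(z₁ ∪ S) ∩ (z₂ ∪ (E ∖ T)) = (z₁ ∩ z₂) ∪ (S ∖ T)` for `S ⊆ E` and `z₁, z₂` disjoint from `E`. -/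
lemma inter_pin_eq {E z₁ z₂ S T : Finset α} (hS : S ⊆ E) (h₁ : Disjoint z₁ E)
    (h₂ : Disjoint z₂ E) :
    (z₁ ∪ S) ∩ (z₂ ∪ (E \ T)) = (z₁ ∩ z₂) ∪ (S \ T) := by
  ext a
  simp only [Finset.mem_inter, Finset.mem_union, Finset.mem_sdiff]
  have h₁' : a ∈ z₁ → a ∉ E := fun ha hE => Finset.disjoint_left.1 h₁ ha hE
  have h₂' : a ∈ z₂ → a ∉ E := fun ha hE => Finset.disjoint_left.1 h₂ ha hE
  constructor
  · rintro ⟨h | h, h' | ⟨hE, hT⟩⟩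
    · exact Or.inl ⟨h, h'⟩
    · exact absurd hE (h₁' h)
    · exact absurd (hS h) (h₂' h')
    · exact Or.inr ⟨h, hT⟩
  · rintro (⟨h, h'⟩ | ⟨h, hT⟩)
    · exact ⟨Or.inl h, Or.inl h'⟩
    · exact ⟨Or.inr h, Or.inr ⟨hS h, hT⟩⟩

omit [LinearOrder R] [IsStrictOrderedRing R] in
/-- Reindexing a powerset sum by the complement. -/
lemma sum_powerset_sdiff (E : Finset α) (f : Finset α → R) :
    ∑ W ∈ E.powerset, f (E \ W) = ∑ W ∈ E.powerset, f W := by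
  refine Finset.sum_nbij' (fun W => E \ W) (fun W => E \ W) ?_ ?_ ?_ ?_ ?_
  · intro W _
    exact Finset.mem_powerset.2 Finset.sdiff_subset
  · intro W _
    exact Finset.mem_powerset.2 Finset.sdiff_subset
  · intro W hW
    exact Finset.sdiff_sdiff_eq_self (Finset.mem_powerset.1 hW)
  · intro W hW
    exact Finset.sdiff_sdiff_eq_self (Finset.mem_powerset.1 hW)
  · intro W _
    rfl

/-- **The fibre four-functions theorem** (ADDENDUM 23 (3), two-pinning form): under the
Ahlswede–Daykin hypothesis `α(S) β(T) ≤ γ(S ∪ T) δ(S ∩ T)` (nonnegative functions), for a free set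
`E` and pinnings `z₁, z₂` disjoint from `E`,
`Σ_{r ⊆ E} α(z₁ ∪ r) β(z₂ ∪ (E ∖ r)) ≤ Σ_{r ⊆ E} γ(z₁ ∪ z₂ ∪ r) δ((z₁ ∩ z₂) ∪ (E ∖ r))`. -/
theorem fibreFFT (E z₁ z₂ : Finset α) (h₁ : Disjoint z₁ E) (h₂ : Disjoint z₂ E)
    (a b c d : Finset α → R) (ha : ∀ S, 0 ≤ a S) (hb : ∀ S, 0 ≤ b S) (hc : ∀ S, 0 ≤ c S)
    (hd : ∀ S, 0 ≤ d S) (AD : ∀ S T, a S * b T ≤ c (S ∪ T) * d (S ∩ T)) :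
    ∑ r ∈ E.powerset, a (z₁ ∪ r) * b (z₂ ∪ (E \ r)) ≤
      ∑ r ∈ E.powerset, c (z₁ ∪ z₂ ∪ r) * d ((z₁ ∩ z₂) ∪ (E \ r)) := by
  have key := lemma_L E (fun S => a (z₁ ∪ S) * b (z₂ ∪ (E \ S)))
    (fun W => c (z₁ ∪ z₂ ∪ (E \ W)) * d ((z₁ ∩ z₂) ∪ W))
    (fun S => mul_nonneg (ha _) (hb _)) (fun W => mul_nonneg (hc _) (hd _)) (by
      intro S hS T hT
      have e1 := AD (z₁ ∪ S) (z₂ ∪ (E \ T))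
      have e2 := AD (z₁ ∪ T) (z₂ ∪ (E \ S))
      rw [union_pin_eq hS, inter_pin_eq hS h₁ h₂] at e1
      rw [union_pin_eq hT, inter_pin_eq hT h₁ h₂] at e2
      have := mul_le_mul e1 e2 (mul_nonneg (ha _) (hb _)) (mul_nonneg (hc _) (hd _))
      calc a (z₁ ∪ S) * b (z₂ ∪ (E \ S)) * (a (z₁ ∪ T) * b (z₂ ∪ (E \ T)))
          = a (z₁ ∪ S) * b (z₂ ∪ (E \ T)) * (a (z₁ ∪ T) * b (z₂ ∪ (E \ S))) := by ring
        _ ≤ c (z₁ ∪ z₂ ∪ (E \ (T \ S))) * d ((z₁ ∩ z₂) ∪ (S \ T)) *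
            (c (z₁ ∪ z₂ ∪ (E \ (S \ T))) * d ((z₁ ∩ z₂) ∪ (T \ S))) := this
        _ = c (z₁ ∪ z₂ ∪ (E \ (S \ T))) * d ((z₁ ∩ z₂) ∪ (S \ T)) *
            (c (z₁ ∪ z₂ ∪ (E \ (T \ S))) * d ((z₁ ∩ z₂) ∪ (T \ S))) := by ring)
  refine key.trans (le_of_eq ?_)
  rw [← sum_powerset_sdiff E (fun r => c (z₁ ∪ z₂ ∪ r) * d ((z₁ ∩ z₂) ∪ (E \ r)))]
  refine Finset.sum_congr rfl fun W hW => ?_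
  rw [Finset.sdiff_sdiff_eq_self (Finset.mem_powerset.1 hW)]

/-- **Fibre Harris / Kleitman** (ADDENDUM 23, Corollary 3): for up-sets `𝒰, 𝒱` of subsets, every
typed fibre satisfies `#{r ⊆ E : z₁ ∪ r ∈ 𝒰, z₂ ∪ (E ∖ r) ∈ 𝒱} ≤ #{r ⊆ E : z₁ ∪ z₂ ∪ r ∈ 𝒰 ∩ 𝒱}`
(as sums of indicators in `R`). -/
theorem fibreHarris (E z₁ z₂ : Finset α) (h₁ : Disjoint z₁ E) (h₂ : Disjoint z₂ E)
    (𝒰 𝒱 : Set (Finset α)) (h𝒰 : IsUpperSet 𝒰) (h𝒱 : IsUpperSet 𝒱) :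
    ∑ r ∈ E.powerset, 𝒰.indicator (1 : Finset α → R) (z₁ ∪ r) * 𝒱.indicator 1 (z₂ ∪ (E \ r)) ≤
      ∑ r ∈ E.powerset, (𝒰 ∩ 𝒱).indicator (1 : Finset α → R) (z₁ ∪ z₂ ∪ r) := by
  have h := fibreFFT (R := R) E z₁ z₂ h₁ h₂ (𝒰.indicator (1 : Finset α → R))
    (𝒱.indicator (1 : Finset α → R)) ((𝒰 ∩ 𝒱).indicator (1 : Finset α → R)) (fun _ => (1 : R))
    (fun _ => Set.indicator_apply_nonneg fun _ => zero_le_one)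
    (fun _ => Set.indicator_apply_nonneg fun _ => zero_le_one)
    (fun _ => Set.indicator_apply_nonneg fun _ => zero_le_one) (fun _ => zero_le_one) (by
      intro S T
      by_cases hS : S ∈ 𝒰
      · by_cases hT : T ∈ 𝒱
        · have hU : S ∪ T ∈ 𝒰 ∩ 𝒱 :=
            ⟨h𝒰 Finset.subset_union_left hS, h𝒱 Finset.subset_union_right hT⟩
          simp [Set.indicator_of_mem hS, Set.indicator_of_mem hT, Set.indicator_of_mem hU]
        · rw [Set.indicator_of_notMem hT, mul_zero, mul_one]
          exact Set.indicator_apply_nonneg fun _ => zero_le_one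
      · rw [Set.indicator_of_notMem hS, zero_mul, mul_one]
        exact Set.indicator_apply_nonneg fun _ => zero_le_one)
  simp only [mul_one] at h
  exact h

end Fibre

end DAD

end Summit.Ventures.PercRepro2
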